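import Mathlib
import Summits.NavierStokesRegularity.NavierStokesRegularity.Theorems.EulerZoomLiouvillePowerGaugeEulerLiouvilleSelfSimilarPastProfileGradient
import Summits.NavierStokesRegularity.NavierStokesRegularity.Theorems.EulerZoomLiouvillePowerGaugeEulerLiouvillePastTwistedTools
import Summits.NavierStokesRegularity.NavierStokesRegularity.Theorems.EulerZoomLiouvillePowerGaugeEulerLiouvilleKillingRotation
import HarnessLib

/-!
# Crux `EulerZoomLiouville.PowerGaugeEulerLiouville` (stmt-NavierStokesRegularity-19832), line `relative_equilibria` (ns-idea-11), R3a PORT RECIPE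
# brick P3 (first half): IDENTIFICATION OF THE WEAK GRADIENT OF A SPIRAL (Perelman-ansatz) MEMBER on the past sub-slab

Route №10 `EulerZoomLiouville` (NavierStokesRegularity), crux E; width seat ns-ezl-w1 g10 under the LEAD ns-typeII-p2 (R3a recipe of
`Cruxes/PowerGaugeEulerLiouville/Lines/relative-equilibria.md`, brick P3 = spiral twin of `Past.exists_profileGradient_ae_of_past`).

SPIRAL (rotated self-similar) member about `(T, x₀)` with skew generator `S` (`⟪Sx, y⟫ = −⟪x, Sy⟫`) and profile `V`, on the past sub-slab `τ < T₁`
(`T₁ ≤ 0`, `T₁ ≤ T`): `u(τ, x) = λ^{γ−1} e^{(log λ)S} V(e^{−(log λ)S} λ^{−γ}(x − x₀))`, `λ = T − τ` (the line's `IsPastSpiral`, with `twist S s = exp(sS)`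
written out as `NormedSpace.exp (s • S)`).  KEY ALGEBRA (i) of the recipe: each slice is the UNTWISTED slice of the ROTATED profile `Q_λ ∘ V ∘ Q_λ⁻¹`,
so the untwisted brick applies slice-wise and the rotation is undone by isometric conjugation of weak derivatives (`Twisted.hasWeakFDerivOn_conj`).

* `Spiral.exists_rot` — `e^{sS}` as a linear isometry equivalence `R` with `R = e^{sS}`, `R⁻¹ = e^{−sS}` (tree `rss_exists_rot`);
* `Spiral.slice_eq_rotated` — the spiral slice at `τ` is `x ↦ c • V_R (d • (x − x₀))`, `V_R = R ∘ V ∘ R⁻¹`, `c = λ^{γ−1}`, `d = λ^{−γ}`;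
* `Spiral.hasWeakFDerivOn_profile_of_rotatedSlice` — from a weak derivative `K` of that slice to the weak derivative
  `y ↦ R⁻¹ ∘L (c⁻¹ d⁻¹ K(x₀ + d⁻¹ R y)) ∘L R` of `V`;
* ★ `Spiral.exists_profileGradient_ae_of_pastSpiral` — THE BRICK: a profile gradient `G` (a.e.-strongly measurable weak derivative of `V` on `ℝ³`) with
  `H(τ) = λ^{−1} • (Q_λ ∘L G(Q_λ⁻¹ λ^{−γ}(· − x₀)) ∘L Q_λ⁻¹)` a.e. on `ℝ³` for a.e. `τ < T₁` (`Q_λ = e^{(log λ)S}`): the recipe's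
  `G y = λ^{2γ−1} • Q_λ⁻¹ ∘L H τ x ∘L Q_λ` read backwards.  `S = 0` is the tree's untwisted brick.

WHAT THIS IS NOT: not NS, not E, not a stub: one brick (P3, gradient half) of the port R3a of a width sub-line; 19832 OPEN; no summit statement is
proved by this file. [folklore; ChaeTsai2013DSS p. 4 (Perelman's rotated ansatz); PineauVicol2026 §1]
-/

noncomputable section

-- flat `Theorems/<Route><Decl>…` files of one crux share the namespace of the crux (tree convention: `Summit.<S>.<S>.…`)
set_option linter.dupNamespace false

open MeasureTheory Set Filter Topology Metric Function TopologicalSpace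
open scoped ENNReal NNReal RealInnerProductSpace

namespace Summit.NavierStokesRegularity.NavierStokesRegularity.Theorems.PowerGaugeEulerLiouville

open Literature.Analysis Literature.Analysis.FunctionSpaces Literature.Analysis.FluidPDE

namespace Spiral

variable {S : EuclideanSpace ℝ (Fin 3) →L[ℝ] EuclideanSpace ℝ (Fin 3)}

/-- Skewness `⟪Sx, y⟫ = −⟪x, Sy⟫` gives `⟪Sx, x⟫ = 0`. [folklore] -/
theorem inner_self_of_skew (hS : ∀ x y : EuclideanSpace ℝ (Fin 3), ⟪S x, y⟫ = -⟪x, S y⟫) (x : EuclideanSpace ℝ (Fin 3)) :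
    ⟪S x, x⟫ = 0 := by
  have h := hS x x
  rw [real_inner_comm (S x) x] at h
  linarith

/-- **`e^{sS}` as a linear isometry equivalence**: for skew `S` and every `s` there is `R : ℝ³ ≃ₗᵢ ℝ³` with `R = e^{sS}` and `R⁻¹ = e^{−sS}`
(tree `rss_exists_rot`). [folklore] -/
theorem exists_rot (hS : ∀ x y : EuclideanSpace ℝ (Fin 3), ⟪S x, y⟫ = -⟪x, S y⟫) (s : ℝ) :
    ∃ R : EuclideanSpace ℝ (Fin 3) ≃ₗᵢ[ℝ] EuclideanSpace ℝ (Fin 3),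
      (∀ y, R y = NormedSpace.exp (s • S) y) ∧ ∀ y, R.symm y = NormedSpace.exp ((-s) • S) y := by
  obtain ⟨L, hL, hLs⟩ := rss_exists_rot (inner_self_of_skew hS) (-s)
  exact ⟨L, fun y => by rw [hL, neg_neg], hLs⟩

/-- **KEY ALGEBRA (i): the spiral slice is the untwisted slice of the rotated profile.**  With `R = e^{(log λ)S}` (`R⁻¹ = e^{−(log λ)S}`),
`λ^{γ−1} e^{(log λ)S} V(e^{−(log λ)S} λ^{−γ}(x − x₀)) = c • (R ∘ V ∘ R⁻¹)(d • (x − x₀))`, `c = λ^{γ−1}`, `d = λ^{−γ}`. [folklore] -/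
theorem slice_eq_rotated {γ lam : ℝ} (x₀ : EuclideanSpace ℝ (Fin 3)) (V : EuclideanSpace ℝ (Fin 3) → EuclideanSpace ℝ (Fin 3))
    {R : EuclideanSpace ℝ (Fin 3) ≃ₗᵢ[ℝ] EuclideanSpace ℝ (Fin 3)}
    (hR : ∀ y, R y = NormedSpace.exp ((Real.log lam) • S) y) (hRs : ∀ y, R.symm y = NormedSpace.exp ((-Real.log lam) • S) y) :
    (fun x : EuclideanSpace ℝ (Fin 3) => lam ^ (γ - 1) •
        NormedSpace.exp ((Real.log lam) • S) (V (NormedSpace.exp ((-Real.log lam) • S) (lam ^ (-γ) • (x - x₀))))) =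
      fun x => lam ^ (γ - 1) • (fun y => R (V (R.symm y))) (lam ^ (-γ) • (x - x₀)) := by
  funext x
  simp only [hR, hRs]

/-- **From a weak derivative of the rotated, shifted, dilated slice to a weak derivative of the profile.**  If `K` is a weak derivative on `ℝ³` of
`x ↦ c • R(V(R⁻¹(d • (x − x₀))))` (`c, d > 0`, `R` a linear isometry), then `y ↦ R⁻¹ ∘L (c⁻¹ • d⁻¹ • K(x₀ + d⁻¹ • R y)) ∘L R` is a weak
derivative of `V` (untwisted brick `Past.hasWeakFDerivOn_profile_of_shiftedSlice` for `R ∘ V ∘ R⁻¹`, then `Twisted.hasWeakFDerivOn_conj R⁻¹`). [folklore] -/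
theorem hasWeakFDerivOn_profile_of_rotatedSlice {c d : ℝ} (hc : 0 < c) (hd : 0 < d) (x₀ : EuclideanSpace ℝ (Fin 3))
    (R : EuclideanSpace ℝ (Fin 3) ≃ₗᵢ[ℝ] EuclideanSpace ℝ (Fin 3))
    {V : EuclideanSpace ℝ (Fin 3) → EuclideanSpace ℝ (Fin 3)}
    {K : EuclideanSpace ℝ (Fin 3) → EuclideanSpace ℝ (Fin 3) →L[ℝ] EuclideanSpace ℝ (Fin 3)}
    (h : HasWeakFDerivOn (⊤ : Opens (EuclideanSpace ℝ (Fin 3))) volume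
      (fun x => c • (fun y => R (V (R.symm y))) (d • (x - x₀))) K) :
    HasWeakFDerivOn (⊤ : Opens (EuclideanSpace ℝ (Fin 3))) volume V
      (fun y => ((R.symm : EuclideanSpace ℝ (Fin 3) →L[ℝ] EuclideanSpace ℝ (Fin 3)).comp
        ((c⁻¹ • (d⁻¹ • K (x₀ + d⁻¹ • R y))).comp
          ((R.symm).symm : EuclideanSpace ℝ (Fin 3) →L[ℝ] EuclideanSpace ℝ (Fin 3))))) := by
  -- weak derivative of the rotated profile `R ∘ V ∘ R⁻¹`
  have h1 := Past.hasWeakFDerivOn_profile_of_shiftedSlice (V := fun y => R (V (R.symm y))) hc hd x₀ h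
  -- undo the rotation with `R⁻¹`
  have h2 := Twisted.hasWeakFDerivOn_conj R.symm h1
  have e : (fun x => R.symm ((fun y => R (V (R.symm y))) (R.symm.symm x))) = V := by
    funext x
    simp
  rw [e] at h2
  exact h2


/-- The coercion of the rotation `R` (resp. `R⁻¹`) to a continuous linear map is `e^{sS}` (resp. `e^{−sS}`). [folklore] -/
theorem coe_rot_eq {s : ℝ} {R : EuclideanSpace ℝ (Fin 3) ≃ₗᵢ[ℝ] EuclideanSpace ℝ (Fin 3)}
    (hR : ∀ y, R y = NormedSpace.exp (s • S) y) :
    (R : EuclideanSpace ℝ (Fin 3) →L[ℝ] EuclideanSpace ℝ (Fin 3)) = NormedSpace.exp (s • S) := by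
  ext y i
  simp [hR]

/-! ### The brick: identification of the weak gradient of a spiral member -/

/-- ★ **IDENTIFICATION OF THE WEAK GRADIENT OF A SPIRAL (PAST-EXACT, ROTATED SELF-SIMILAR) MEMBER.**  Let `H` be a weak spatial gradient of `u` on the
slab `(−∞,0) × ℝ³`, and suppose `u(τ, x) = λ^{γ−1} e^{(log λ)S} V(e^{−(log λ)S} λ^{−γ}(x − x₀))` for `τ < T₁` (`λ = T − τ`; `T₁ ≤ 0`, `T₁ ≤ T`; `S` skew).
Then there is a profile gradient `G` — a.e.-strongly measurable, a weak derivative of `V` on `ℝ³` — with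
`H(τ) = λ^{−1} • (e^{(log λ)S} ∘L G(e^{−(log λ)S} λ^{−γ}(· − x₀)) ∘L e^{−(log λ)S})` a.e. on `ℝ³` for a.e. `τ < T₁` (the weak form of the chain rule
`∇u = λ^{−1} Q (∇V)(Q⁻¹·) Q⁻¹`).  Proof = the untwisted brick `Past.exists_profileGradient_ae_of_past` slice by slice on the ROTATED profile `Q_λ ∘ V ∘ Q_λ⁻¹`
(KEY ALGEBRA (i)), the rotation undone by `Twisted.hasWeakFDerivOn_conj`, uniqueness of weak derivatives, and transport along the measure-preserving
`x ↦ Q_λ⁻¹ λ^{−γ}(x − x₀)`; `S = 0` is the untwisted brick. [folklore; ChaeTsai2013DSS p. 4] -/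
theorem exists_profileGradient_ae_of_pastSpiral {γ : ℝ}
    {u : ℝ → EuclideanSpace ℝ (Fin 3) → EuclideanSpace ℝ (Fin 3)}
    {H : ℝ → EuclideanSpace ℝ (Fin 3) → EuclideanSpace ℝ (Fin 3) →L[ℝ] EuclideanSpace ℝ (Fin 3)}
    (hH : HasWeakSpatialGradientOn (slab (EuclideanSpace ℝ (Fin 3)) (Iio 0) isOpen_Iio) u H)
    {T T₁ : ℝ} (hT₁ : T₁ ≤ 0) (hTT₁ : T₁ ≤ T) (x₀ : EuclideanSpace ℝ (Fin 3))
    (hS : ∀ x y : EuclideanSpace ℝ (Fin 3), ⟪S x, y⟫ = -⟪x, S y⟫)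
    {V : EuclideanSpace ℝ (Fin 3) → EuclideanSpace ℝ (Fin 3)}
    (hu : ∀ τ : ℝ, τ < T₁ → u τ = fun x => (T - τ) ^ (γ - 1) •
      NormedSpace.exp ((Real.log (T - τ)) • S) (V (NormedSpace.exp ((-Real.log (T - τ)) • S) ((T - τ) ^ (-γ) • (x - x₀))))) :
    ∃ G : EuclideanSpace ℝ (Fin 3) → EuclideanSpace ℝ (Fin 3) →L[ℝ] EuclideanSpace ℝ (Fin 3),
      AEStronglyMeasurable G volume ∧
      HasWeakFDerivOn (⊤ : Opens (EuclideanSpace ℝ (Fin 3))) volume V G ∧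
      ∀ᵐ τ ∂((volume : Measure ℝ).restrict (Iio T₁)),
        H τ =ᵐ[volume] fun x => (T - τ) ^ (-1 : ℝ) •
          ((NormedSpace.exp ((Real.log (T - τ)) • S)).comp
            ((G (NormedSpace.exp ((-Real.log (T - τ)) • S) ((T - τ) ^ (-γ) • (x - x₀)))).comp
              (NormedSpace.exp ((-Real.log (T - τ)) • S)))) := by
  have hsub : Iio T₁ ⊆ Iio (0 : ℝ) := Iio_subset_Iio hT₁
  -- (1) a.e. slice below `0` is a weak derivative on `ℝ³`
  have hslice0 : ∀ᵐ τ ∂((volume : Measure ℝ).restrict (Iio (0 : ℝ))),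
      HasWeakFDerivOn (⊤ : Opens (EuclideanSpace ℝ (Fin 3))) volume (u τ) (H τ) := by
    have hU : (Iio (0 : ℝ)) = ⋃ n : ℕ, Ioo (-((n : ℝ) + 1)) 0 := by
      refine subset_antisymm (fun t ht => mem_iUnion.2 ?_) (iUnion_subset fun n t ht => ht.2)
      obtain ⟨n, hn⟩ := exists_nat_gt (-t)
      exact ⟨n, ⟨by linarith, ht⟩⟩
    rw [hU, ae_restrict_iUnion_iff]
    intro n
    have hn : HasWeakSpatialGradientOn
        (slab (EuclideanSpace ℝ (Fin 3)) (Ioo (-((n : ℝ) + 1)) 0) isOpen_Ioo) u H :=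
      hH.mono (slab_mono Ioo_subset_Iio_self)
    exact hn.ae_hasWeakFDerivOn_slice_slab
  have hslice : ∀ᵐ τ ∂((volume : Measure ℝ).restrict (Iio T₁)),
      HasWeakFDerivOn (⊤ : Opens (EuclideanSpace ℝ (Fin 3))) volume (u τ) (H τ) :=
    ae_restrict_of_ae_restrict_of_subset hsub hslice0
  -- (2) a.e. slice of `H` is a.e.-strongly measurable; `τ < T₁` a.e.
  have hHm : AEStronglyMeasurable (uncurry H)
      (((volume : Measure ℝ).restrict (Iio (0 : ℝ))).prod (volume : Measure (EuclideanSpace ℝ (Fin 3)))) := by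
    have := hH.locallyIntegrableOn_grad.aestronglyMeasurable
    rw [coe_slab, Measure.volume_eq_prod, ← Measure.prod_restrict, Measure.restrict_univ] at this
    exact this
  have hmeas : ∀ᵐ τ ∂((volume : Measure ℝ).restrict (Iio T₁)),
      AEStronglyMeasurable (H τ) volume :=
    ae_restrict_of_ae_restrict_of_subset hsub hHm.prodMk_left
  have hlt : ∀ᵐ τ ∂((volume : Measure ℝ).restrict (Iio T₁)), τ < T₁ :=
    ae_restrict_mem measurableSet_Iio
  haveI : (ae ((volume : Measure ℝ).restrict (Iio T₁))).NeBot := by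
    rw [ae_neBot, Ne, Measure.restrict_eq_zero]
    simp
  obtain ⟨τ₀, ⟨hW₀, hm₀⟩, hτ₀⟩ := ((hslice.and hmeas).and hlt).exists
  -- (3) the profile gradient from the slice at `τ₀ < T₁ ≤ T`, read through the rotation `R₀ = e^{(log λ₀)S}`
  have hs₀ : 0 < T - τ₀ := by linarith
  set c₀ : ℝ := (T - τ₀) ^ (γ - 1) with hc₀
  set d₀ : ℝ := (T - τ₀) ^ (-γ) with hd₀
  have hc₀p : 0 < c₀ := Real.rpow_pos_of_pos hs₀ _
  have hd₀p : 0 < d₀ := Real.rpow_pos_of_pos hs₀ _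
  obtain ⟨R₀, hR₀, hR₀s⟩ := exists_rot hS (Real.log (T - τ₀))
  have huslice₀ : u τ₀ = fun x => c₀ • (fun y => R₀ (V (R₀.symm y))) (d₀ • (x - x₀)) := by
    rw [hu τ₀ hτ₀, slice_eq_rotated x₀ V hR₀ hR₀s]
  set G : EuclideanSpace ℝ (Fin 3) → EuclideanSpace ℝ (Fin 3) →L[ℝ] EuclideanSpace ℝ (Fin 3) :=
    fun y => ((R₀.symm : EuclideanSpace ℝ (Fin 3) →L[ℝ] EuclideanSpace ℝ (Fin 3)).comp
      ((c₀⁻¹ • (d₀⁻¹ • H τ₀ (x₀ + d₀⁻¹ • R₀ y))).comp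
        ((R₀.symm).symm : EuclideanSpace ℝ (Fin 3) →L[ℝ] EuclideanSpace ℝ (Fin 3)))) with hG
  have hVG : HasWeakFDerivOn (⊤ : Opens (EuclideanSpace ℝ (Fin 3))) volume V G := by
    rw [huslice₀] at hW₀
    exact hasWeakFDerivOn_profile_of_rotatedSlice hc₀p hd₀p x₀ R₀ hW₀
  have hGm : AEStronglyMeasurable G volume := by
    have hq : Measure.QuasiMeasurePreserving (fun y : EuclideanSpace ℝ (Fin 3) => x₀ + d₀⁻¹ • R₀ y) volume volume :=
      (Past.quasiMeasurePreserving_add_smul (inv_pos.2 hd₀p).ne' x₀).comp R₀.measurePreserving.quasiMeasurePreserving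
    have h1 : AEStronglyMeasurable (fun y => H τ₀ (x₀ + d₀⁻¹ • R₀ y)) volume := hm₀.comp_quasiMeasurePreserving hq
    have h2 : AEStronglyMeasurable (fun y => c₀⁻¹ • (d₀⁻¹ • H τ₀ (x₀ + d₀⁻¹ • R₀ y))) volume :=
      (h1.const_smul d₀⁻¹).const_smul c₀⁻¹
    have hcont : Continuous fun A : EuclideanSpace ℝ (Fin 3) →L[ℝ] EuclideanSpace ℝ (Fin 3) =>
        ((R₀.symm : EuclideanSpace ℝ (Fin 3) →L[ℝ] EuclideanSpace ℝ (Fin 3)).comp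
          (A.comp ((R₀.symm).symm : EuclideanSpace ℝ (Fin 3) →L[ℝ] EuclideanSpace ℝ (Fin 3)))) :=
      continuous_const.clm_comp (continuous_id.clm_comp continuous_const)
    exact hcont.comp_aestronglyMeasurable h2
  refine ⟨G, hGm, hVG, ?_⟩
  -- (4) for every good `τ < T₁`: uniqueness of the weak derivative of `V`, transported along `x ↦ e^{−(log λ)S} λ^{−γ}(x − x₀)`
  filter_upwards [hslice, hlt] with τ hWτ hτ
  have hs : 0 < T - τ := by linarith
  set c : ℝ := (T - τ) ^ (γ - 1) with hcdef
  set d : ℝ := (T - τ) ^ (-γ) with hddef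
  have hcp : 0 < c := Real.rpow_pos_of_pos hs _
  have hdp : 0 < d := Real.rpow_pos_of_pos hs _
  obtain ⟨R, hR, hRs⟩ := exists_rot hS (Real.log (T - τ))
  have huslice : u τ = fun x => c • (fun y => R (V (R.symm y))) (d • (x - x₀)) := by
    rw [hu τ hτ, slice_eq_rotated x₀ V hR hRs]
  rw [huslice] at hWτ
  have hVG' := hasWeakFDerivOn_profile_of_rotatedSlice hcp hdp x₀ R hWτ
  have huniq := HasWeakFDerivOn.unique_holds hVG' hVG
  rw [Opens.coe_top, Measure.restrict_univ] at huniq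
  -- transport along `ψ x = R⁻¹ (d • (x − x₀))`
  have hψ : Measure.QuasiMeasurePreserving (fun x : EuclideanSpace ℝ (Fin 3) => R.symm (d • (x - x₀))) volume volume :=
    R.symm.measurePreserving.quasiMeasurePreserving.comp (Past.quasiMeasurePreserving_smul_sub hdp.ne' x₀)
  have ht := hψ.ae_eq_comp huniq
  filter_upwards [ht] with x hx
  simp only [comp_apply, LinearIsometryEquiv.apply_symm_apply, smul_smul, inv_mul_cancel₀ hdp.ne', one_smul,
    add_sub_cancel] at hx
  -- `hx : R⁻¹ ∘L ((c⁻¹ • d⁻¹ • H τ x) ∘L R) = G (R⁻¹ (d • (x − x₀)))`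
  have hcd : c * d = (T - τ) ^ (-1 : ℝ) := by
    rw [hcdef, hddef, ← Real.rpow_add hs]
    congr 1; ring
  have key : H τ x = (c * d) • ((R : EuclideanSpace ℝ (Fin 3) →L[ℝ] EuclideanSpace ℝ (Fin 3)).comp
      ((G (R.symm (d • (x - x₀)))).comp (R.symm : EuclideanSpace ℝ (Fin 3) →L[ℝ] EuclideanSpace ℝ (Fin 3)))) := by
    rw [← hx]
    apply ContinuousLinearMap.ext; intro v
    simp only [LinearIsometryEquiv.symm_symm, FunLike.coe_smul, Pi.smul_apply, ContinuousLinearMap.coe_comp, comp_apply]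
    simp only [smul_smul, LinearIsometryEquiv.coe_coe'', LinearIsometryEquiv.apply_symm_apply, map_smul]
    rw [show c * d * (c⁻¹ * d⁻¹) = 1 by field_simp, one_smul]
  rw [key, hcd, coe_rot_eq hR, coe_rot_eq hRs, hRs]

end Spiral

end Summit.NavierStokesRegularity.NavierStokesRegularity.Theorems.PowerGaugeEulerLiouville

end
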